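import Mathlib
import Summits.Ventures.HodgeRepro.Tier4.Common.AdelicDefs
import Summits.Ventures.HodgeRepro.Tier4.Common.AdelicRTF
import Summits.Ventures.HodgeRepro.Tier4.Common.CompactOpenLevel
import Summits.Ventures.HodgeRepro.Tier4.Common.LevelBasis
import Summits.Ventures.HodgeRepro.Tier4.Line1.PlaneDefs
import Summits.Ventures.HodgeRepro.Tier4.Line1.RationalPoints
import Summits.Ventures.HodgeRepro.Tier4.Line1.IsolatingTestsDeepLevel
import Summits.Ventures.HodgeRepro.Tier4.Line1.AdelicParts
import Summits.Ventures.HodgeRepro.Tier4.Line1.FiniteLevelIsolation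

/-!
# Tier4/Line4/FinitePlacePositivity — C-L4-FINPOS: at a deep level the character product is POSITIVE on the pairs
whose FINITE PART is near the stabiliser

Blind re-derivation cell `pub-hodge-repro`, Tier 4 «PROVE THE STEP» (README §9–§10), LINE L4, cut C-L4-FINPOS
(t4-crit-2 g4 Entry 102 = S14038; conceded statement-sized by t4-plan-4 g2 S14047; lead's re-point S14140; statement
by name S14155; ADJUDICATED with the finite-part amendment by t4-plan-4 g2 S14158); seat t4-L2-p3 (gen 3).

THE CLAIM (Entry 102): at a level `N` deeper than the conductors of `χ_v, χ′_v`, the pairs `(t, t′)` with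
`t⁻¹ γ₀ t′ ∈ K_v(N) γ₀ K_v(N)` lie in a small neighbourhood of the stabiliser `{(z, z)}`, where
`χ_v(t) χ̄′_v(t′) = χ_v(z) χ̄′_v(z) = 1` (`chi_centre`), so the finite local factor is `I_v = vol > 0`.  The tree has no
typed local factor (the orbital integral `RTFData.orbitalc` is the adelic double integral over `[T] × [T′]`), so the
claim is typed ADELICALLY ON THE FINITE PART (S14158): the hypothesis is on `GA.ofFinPart (t⁻¹ γ₀ t′)` — the
finite part of the pair's orbit point lies in `K(N) γ₀_f K(N)`, `γ₀_f = GA.ofFinPart γ₀` — and the conclusion is on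
the finite-part characters `χ(t_f) conj χ′(t′_f)`, `t_f = GA.ofFinPart t` (the archimedean factor
`χ_∞(t_∞) χ̄′_∞(t′_∞)` is the real places' business, C-L4-WFIBRE, separated by `chi_mul` +
`GA.ofInfPart_mul_ofFinPart`).  The conclusion «POSITIVE REAL PART» needs only the continuity of the characters and
`chi_centre`, not local constancy (a character value `‖χ(z_f)‖²` on the stabiliser, `> 0`; the sum of such values is
the positive volume).

* `levelDoubleCoset W N γ = K(N) γ K(N)`: antitone in `N` along divisibility (`levelK_antitone`), compact
  (`isCompact_levelK`), and a neighbourhood basis of `γ` (`exists_levelDoubleCoset_subset_nhds`, from t4-typer-2's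
  `exists_levelK_subset_nhds_one` and the continuity of `(a, b) ↦ a γ b`);
* the finite-part projection `GA.ofFinPart` (FiniteLevelIsolation) is a continuous group endomorphism of `G(𝔸_k)`
  (`continuous_ofFinPart`, `ofFinPart_mul`, `ofFinPart_inv`), commutes with the archimedean parts
  (`ofFinPart_mul_ofInfPart_comm`) and preserves the commutants, hence the tori (`ofFinPart_mem_torusT`,
  `ofFinPart_mem_torusT'`; `finT`, `finT'` are the induced continuous self-maps of the tori);
* `ofFinPart_conj_eq_of_ofFinPart_eq`: if the finite part of `t⁻¹ γ₀ t′` is `γ₀_f`, then `(t_f, t′_f)` is a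
  stabiliser pair of `γ₀` itself (`γ₀ = γ₀_∞ γ₀_f` and `t_f` commutes with `γ₀_∞`), so by `IsRegularRational` it is
  `(z, z)` with `z` central;
* **`exists_level_re_pos_of_regular`**: for `R : RTFData W` with continuous characters (`hχ`, `hχ'`) normalised by
  `χ(1) = 1`, a linearly regular `γ₀` (`IsRegularRational`: the stabiliser of `γ₀` in `T × T′` is the diagonal
  centre) and compact `closure DT`, `closure DT′`: there is `N ≠ 0` such that for every `t ∈ closure DT`,
  `t′ ∈ closure DT′` with `GA.ofFinPart (t⁻¹ γ₀ t′) ∈ K(N) γ₀_f K(N)` and every pair of membership proofs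
  `t_f ∈ T`, `t′_f ∈ T′`, `0 < Re(χ(t_f) conj χ′(t′_f))`.  Proof: the compact sets
  `A_n = (closure DT × closure DT′) ∩ f⁻¹(K((n+1)!) γ₀_f K((n+1)!)) ∩ Uᶜ`, `f(t, t′) = GA.ofFinPart (t⁻¹ γ₀ t′)`,
  `U = {Re(χ(t_f) conj χ′(t′_f)) > 0}` (open), decrease; a point of their intersection has `f = γ₀_f` (Hausdorff +
  the basis), hence is a stabiliser pair `(z, z)` where the product is `‖χ(z)‖² > 0` — contradiction; so some `A_n`
  is empty, which is the claim at level `(n+1)!`.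

WHAT IT IS NOT: the real places are C-L4-WFIBRE / C-L4-W0REL (S14047), not this module.  The binders `hχ`, `hχ'`,
`hχ1` are the continuity and normalisation of the characters that `RTFData` does not carry.  No printed input is
consumed; nothing here asserts anything about the truth of (P); HC_CM is NOT proved by anyone in this repository.
-/

set_option autoImplicit false

noncomputable section

namespace Summit.Ventures.HodgeRepro.Tier4.Line4

open Summit.Ventures.HodgeRepro.Tier4 Summit.Ventures.HodgeRepro.Tier4.Common
  Summit.Ventures.HodgeRepro.Tier4.Line1
open scoped ComplexConjugate Topology Pointwise

variable {k : Type} [Field k] [NumberField k] (W : PlaneData k)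

/-! ### 1. The double cosets `K(N) γ₀ K(N)` -/

/-- The double coset `K(N) γ₀ K(N)` of the level subgroup. -/
def levelDoubleCoset (N : ℕ) (γ₀ : GA W) : Set (GA W) :=
  (levelK W N : Set (GA W)) * {γ₀} * (levelK W N : Set (GA W))

/-- The double cosets decrease along divisibility of the level. -/
theorem levelDoubleCoset_antitone {M N : ℕ} (h : M ∣ N) (γ₀ : GA W) :
    levelDoubleCoset W N γ₀ ⊆ levelDoubleCoset W M γ₀ := by
  unfold levelDoubleCoset
  have hle : (levelK W N : Set (GA W)) ⊆ (levelK W M : Set (GA W)) :=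
    fun g hg => SetLike.mem_coe.2 ((levelK_antitone W h) (SetLike.mem_coe.1 hg))
  exact Set.mul_subset_mul (Set.mul_subset_mul_right hle) hle

/-- The double coset at a non-zero level is compact. -/
theorem isCompact_levelDoubleCoset {N : ℕ} (hN : N ≠ 0) (γ₀ : GA W) : IsCompact (levelDoubleCoset W N γ₀) :=
  ((isCompact_levelK W hN).mul isCompact_singleton).mul (isCompact_levelK W hN)

/-- Membership in a double coset `S γ₀ S`, unpacked. -/
theorem exists_eq_mul_of_mem_mul_singleton_mul (S : Set (GA W)) (γ₀ g : GA W) (hg : g ∈ S * {γ₀} * S) :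
    ∃ a ∈ S, ∃ c ∈ S, g = a * γ₀ * c := by
  obtain ⟨x, hx, c, hc, hxc⟩ := Set.mem_mul.1 hg
  obtain ⟨a, ha, g₀, hg₀, hag⟩ := Set.mem_mul.1 hx
  rw [Set.mem_singleton_iff] at hg₀
  refine ⟨a, ha, c, hc, ?_⟩
  rw [← hxc, ← hag, hg₀]

/-- The multiplication `(a, b) ↦ a γ₀ b` tends to `γ₀` at `(1, 1)`. -/
theorem tendsto_mul_mul_one_one (γ₀ : GA W) :
    Filter.Tendsto (fun p : GA W × GA W => p.1 * γ₀ * p.2) (𝓝 (1, 1)) (𝓝 γ₀) := by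
  have hc : Filter.Tendsto (fun p : GA W × GA W => p.1 * γ₀ * p.2) (𝓝 (1, 1))
      (𝓝 ((fun p : GA W × GA W => p.1 * γ₀ * p.2) (1, 1))) :=
    ((continuous_fst.mul continuous_const).mul continuous_snd).tendsto (1, 1)
  simpa using hc

/-- **The double cosets form a neighbourhood basis of `γ₀`**: every neighbourhood of `γ₀` contains some
`K(N) γ₀ K(N)`, `N ≠ 0`. -/
theorem exists_levelDoubleCoset_subset_nhds (γ₀ : GA W) {V : Set (GA W)} (hV : V ∈ 𝓝 γ₀) :
    ∃ N : ℕ, N ≠ 0 ∧ levelDoubleCoset W N γ₀ ⊆ V := by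
  have hpre : (fun p : GA W × GA W => p.1 * γ₀ * p.2) ⁻¹' V ∈ 𝓝 ((1 : GA W), (1 : GA W)) :=
    tendsto_mul_mul_one_one W γ₀ hV
  obtain ⟨V₁, hV₁, V₂, hV₂, hsub⟩ := mem_nhds_prod_iff.1 hpre
  obtain ⟨N₁, hN₁, h₁⟩ := exists_levelK_subset_nhds_one W hV₁
  obtain ⟨N₂, hN₂, h₂⟩ := exists_levelK_subset_nhds_one W hV₂
  refine ⟨N₁ * N₂, mul_ne_zero hN₁ hN₂, fun g hg => ?_⟩
  unfold levelDoubleCoset at hg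
  obtain ⟨a, ha, c, hc, hg'⟩ :=
    exists_eq_mul_of_mem_mul_singleton_mul W (levelK W (N₁ * N₂) : Set (GA W)) γ₀ g hg
  have hle₁ : levelK W (N₁ * N₂) ≤ levelK W N₁ := levelK_antitone W (dvd_mul_right N₁ N₂)
  have hle₂ : levelK W (N₁ * N₂) ≤ levelK W N₂ := levelK_antitone W (dvd_mul_left N₂ N₁)
  have ha' : a ∈ V₁ := h₁ (hle₁ ha)
  have hc' : c ∈ V₂ := h₂ (hle₂ hc)
  have hmem : ((a, c) : GA W × GA W) ∈ V₁ ×ˢ V₂ := Set.mk_mem_prod ha' hc'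
  have h3 : ((a, c) : GA W × GA W) ∈ (fun p : GA W × GA W => p.1 * γ₀ * p.2) ⁻¹' V := hsub hmem
  rw [Set.mem_preimage] at h3
  rw [hg']
  exact h3

/-- A point lying in every `K((n+1)!) γ₀ K((n+1)!)` is `γ₀` (Hausdorff + the basis). -/
theorem eq_of_mem_levelDoubleCoset_factorial (γ₀ g : GA W)
    (hg : ∀ n : ℕ, g ∈ levelDoubleCoset W (n + 1).factorial γ₀) : g = γ₀ := by
  haveI : T2Space (GA W) := t2Space_GA W
  by_contra hne
  have hV : ({g}ᶜ : Set (GA W)) ∈ 𝓝 γ₀ :=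
    (isClosed_singleton.isOpen_compl).mem_nhds (by simpa using Ne.symm hne)
  obtain ⟨N, hN, hsub⟩ := exists_levelDoubleCoset_subset_nhds W γ₀ hV
  have hdvd : N ∣ (N + 1).factorial := Nat.dvd_factorial (Nat.pos_of_ne_zero hN) (Nat.le_succ N)
  have hmem : g ∈ levelDoubleCoset W N γ₀ := levelDoubleCoset_antitone W hdvd γ₀ (hg N)
  exact hsub hmem rfl

/-! ### 2. The finite-part projection `GA.ofFinPart` -/

/-- The finite part of `1` is `1`. -/
theorem ofFinPart_one : GA.ofFinPart W 1 = 1 := by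
  apply Subtype.ext
  apply Units.ext
  change GA.mat W (GA.ofFinPart W 1) = (1 : M4 k)
  have h1 : GA.mat W (1 : GA W) = (1 : M4 k) := rfl
  rw [GA.mat_ofFinPart, h1]
  apply M4_ext
  · rw [infM_mixM, infM_one]
  · rw [finM_mixM]

/-- The finite part of a product is the product of the finite parts. -/
theorem ofFinPart_mul (g h : GA W) : GA.ofFinPart W (g * h) = GA.ofFinPart W g * GA.ofFinPart W h := by
  apply Subtype.ext
  apply Units.ext
  change GA.mat W (GA.ofFinPart W (g * h)) = GA.mat W (GA.ofFinPart W g) * GA.mat W (GA.ofFinPart W h)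
  rw [GA.mat_ofFinPart, GA.mat_ofFinPart, GA.mat_ofFinPart, GA.mat_mul]
  apply M4_ext
  · simp only [infM_mul, infM_mixM, Matrix.one_mul]
  · simp only [finM_mul, finM_mixM]

/-- The finite part of an inverse is the inverse of the finite part. -/
theorem ofFinPart_inv (g : GA W) : GA.ofFinPart W g⁻¹ = (GA.ofFinPart W g)⁻¹ := by
  apply eq_inv_of_mul_eq_one_left
  rw [← ofFinPart_mul, inv_mul_cancel, ofFinPart_one]

/-- A finite part commutes with an archimedean part. -/
theorem ofFinPart_mul_ofInfPart_comm (g h : GA W) :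
    GA.ofFinPart W g * GA.ofInfPart W h = GA.ofInfPart W h * GA.ofFinPart W g := by
  apply Subtype.ext
  apply Units.ext
  change GA.mat W (GA.ofFinPart W g) * GA.mat W (GA.ofInfPart W h) =
    GA.mat W (GA.ofInfPart W h) * GA.mat W (GA.ofFinPart W g)
  rw [GA.mat_ofFinPart, GA.mat_ofInfPart]
  apply M4_ext
  · simp only [infM_mul, infM_mixM, Matrix.one_mul, Matrix.mul_one]
  · simp only [finM_mul, finM_mixM, Matrix.one_mul, Matrix.mul_one]

/-- The finite part of an element of a commutant lies in the commutant (entrywise projection). -/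
theorem ofFinPart_mem_commutant (A : Matrix (Fin 4) (Fin 4) k) {g : GA W} (hg : g ∈ commutant W A) :
    GA.ofFinPart W g ∈ commutant W A := by
  have hg' : GA.mat W g * adMat k A = adMat k A * GA.mat W g := hg
  change GA.mat W (GA.ofFinPart W g) * adMat k A = adMat k A * GA.mat W (GA.ofFinPart W g)
  rw [GA.mat_ofFinPart]
  apply M4_ext
  · simp only [infM_mul, infM_mixM, Matrix.one_mul, Matrix.mul_one]
  · have h2 := congrArg (finM k) hg'
    rw [finM_mul, finM_mul] at h2
    simp only [finM_mul, finM_mixM]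
    exact h2

/-- The finite part of an element of `T` lies in `T`. -/
theorem ofFinPart_mem_torusT {g : GA W} (hg : g ∈ torusT W) : GA.ofFinPart W g ∈ torusT W :=
  Subgroup.mem_inf.2 ⟨ofFinPart_mem_commutant W _ (Subgroup.mem_inf.1 hg).1,
    ofFinPart_mem_commutant W _ (Subgroup.mem_inf.1 hg).2⟩

/-- The finite part of an element of `T′` lies in `T′`. -/
theorem ofFinPart_mem_torusT' {g : GA W} (hg : g ∈ torusT' W) : GA.ofFinPart W g ∈ torusT' W :=
  Subgroup.mem_inf.2 ⟨ofFinPart_mem_commutant W _ (Subgroup.mem_inf.1 hg).1,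
    ofFinPart_mem_commutant W _ (Subgroup.mem_inf.1 hg).2⟩

/-- `GA.ofFinPart` is continuous (entrywise projection to the finite adeles). -/
theorem continuous_ofFinPart : Continuous (GA.ofFinPart W) := by
  have hmat : Continuous fun g : GA W => GA.mat W g := Units.continuous_val.comp continuous_subtype_val
  have hmatinv : Continuous fun g : GA W => GA.mat W g⁻¹ := by
    have h1 : Continuous fun g : GA W => ((g : GL4 k)⁻¹ : GL4 k) := continuous_inv.comp continuous_subtype_val
    exact Units.continuous_val.comp h1
  have hmix : ∀ F : GA W → M4 k, Continuous F → Continuous fun g => mixM k 1 (finM k (F g)) := by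
    intro F hF
    refine continuous_matrix fun i j => ?_
    show Continuous fun g => ((1 : Matrix (Fin 4) (Fin 4) (NumberField.InfiniteAdeleRing k)) i j, finPart k (F g i j))
    exact continuous_const.prodMk (continuous_finPart.comp (hF.matrix_elem i j))
  refine Continuous.subtype_mk ?_ _
  refine Units.continuous_iff.2 ⟨?_, ?_⟩
  · exact hmix (fun g => GA.mat W g) hmat
  · exact hmix (fun g => GA.mat W g⁻¹) hmatinv

/-- The finite part of an element of `T`, as an element of `T`. -/
def finT (t : torusT W) : torusT W := ⟨GA.ofFinPart W t, ofFinPart_mem_torusT W t.2⟩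

/-- The finite part of an element of `T′`, as an element of `T′`. -/
def finT' (t : torusT' W) : torusT' W := ⟨GA.ofFinPart W t, ofFinPart_mem_torusT' W t.2⟩

/-- `finT` is continuous. -/
theorem continuous_finT : Continuous (finT W) :=
  ((continuous_ofFinPart W).comp continuous_subtype_val).subtype_mk _

/-- `finT'` is continuous. -/
theorem continuous_finT' : Continuous (finT' W) :=
  ((continuous_ofFinPart W).comp continuous_subtype_val).subtype_mk _

/-- **Finite-part stabiliser pairs are stabiliser pairs**: if the finite part of `t⁻¹ γ₀ t′` is the finite part of
`γ₀`, then `t_f⁻¹ γ₀ t′_f = γ₀` (`γ₀ = γ₀_∞ γ₀_f`, and `t_f⁻¹` commutes with `γ₀_∞`). -/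
theorem ofFinPart_conj_eq_of_ofFinPart_eq (γ₀ t t' : GA W)
    (h : GA.ofFinPart W (t⁻¹ * γ₀ * t') = GA.ofFinPart W γ₀) :
    (GA.ofFinPart W t)⁻¹ * γ₀ * GA.ofFinPart W t' = γ₀ := by
  rw [ofFinPart_mul, ofFinPart_mul, ofFinPart_inv] at h
  have hcomm : ∀ x : GA W, (GA.ofFinPart W t)⁻¹ * (GA.ofInfPart W γ₀ * x) =
      GA.ofInfPart W γ₀ * ((GA.ofFinPart W t)⁻¹ * x) := by
    intro x
    rw [← mul_assoc, ← ofFinPart_inv, ofFinPart_mul_ofInfPart_comm, mul_assoc]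
  calc (GA.ofFinPart W t)⁻¹ * γ₀ * GA.ofFinPart W t'
      = (GA.ofFinPart W t)⁻¹ * (GA.ofInfPart W γ₀ * GA.ofFinPart W γ₀) * GA.ofFinPart W t' := by
        rw [GA.ofInfPart_mul_ofFinPart]
    _ = GA.ofInfPart W γ₀ * ((GA.ofFinPart W t)⁻¹ * GA.ofFinPart W γ₀ * GA.ofFinPart W t') := by
        simp only [mul_assoc]
        exact hcomm _
    _ = GA.ofInfPart W γ₀ * GA.ofFinPart W γ₀ := by rw [h]
    _ = γ₀ := GA.ofInfPart_mul_ofFinPart W γ₀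

/-! ### 3. C-L4-FINPOS -/

variable [MeasurableSpace (torusT W)] [MeasurableSpace (torusT' W)]

/-- A character normalised by `χ(1) = 1` never vanishes. -/
theorem chi_ne_zero_of_one (R : RTFData W) (hχ1 : R.chi 1 = 1) (t : torusT W) : R.chi t ≠ 0 := by
  have h := R.chi_mul t t⁻¹
  rw [mul_inv_cancel, hχ1] at h
  exact left_ne_zero_of_mul_eq_one h.symm

/-- **On a stabiliser pair `(z, z)` the character product is `‖χ(z)‖² > 0`** (`chi_centre`). -/
theorem re_pos_of_stabiliser (R : RTFData W) (hχ1 : R.chi 1 = 1) (t : torusT W) (t' : torusT' W)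
    (hz : (t : GA W) ∈ centre W) (hte : (t' : GA W) = t) : 0 < (R.chi t * conj (R.chi' t')).re := by
  have h1 : R.chi' t' = R.chi t := by
    have hc := R.chi_centre (t : GA W) hz
    have e1 : (⟨(t : GA W), centre_le_torusT W hz⟩ : torusT W) = t := Subtype.ext rfl
    have e2 : (⟨(t : GA W), centre_le_torusT' W hz⟩ : torusT' W) = t' := Subtype.ext hte.symm
    rw [e1, e2] at hc
    exact hc.symm
  rw [h1, Complex.mul_conj, Complex.ofReal_re]
  exact Complex.normSq_pos.mpr (chi_ne_zero_of_one W R hχ1 t)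

/-- **C-L4-FINPOS (t4-crit-2 g4 Entry 102; adelic form on the finite part, t4-plan-4 g2 S14158).** For
`R : RTFData W` with continuous characters normalised by `χ(1) = 1`, a linearly regular `γ₀` and compact
`closure DT`, `closure DT′`: at a deep enough level `N`, every pair `t ∈ closure DT`, `t′ ∈ closure DT′` whose
orbit point has finite part in `K(N) γ₀_f K(N)` has `0 < Re(χ(t_f) conj χ′(t′_f))` on the finite parts
`t_f = GA.ofFinPart t ∈ T`, `t′_f = GA.ofFinPart t′ ∈ T′` — the pairs at a deep level lie near the stabiliser,
where the character product is `‖χ(z)‖² > 0`. -/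
theorem exists_level_re_pos_of_regular (R : RTFData W) (hχ : Continuous R.chi) (hχ' : Continuous R.chi')
    (hχ1 : R.chi 1 = 1) (γ₀ : rationalPoints W) (hreg : IsRegularRational W γ₀)
    (hT : IsCompact (closure R.DT)) (hT' : IsCompact (closure R.DT')) :
    ∃ N : ℕ, N ≠ 0 ∧ ∀ t ∈ closure R.DT, ∀ t' ∈ closure R.DT',
      GA.ofFinPart W ((t : GA W)⁻¹ * γ₀ * t') ∈
          (levelK W N : Set (GA W)) * {GA.ofFinPart W (γ₀ : GA W)} * (levelK W N : Set (GA W)) →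
        ∀ (ht : GA.ofFinPart W (t : GA W) ∈ torusT W) (ht' : GA.ofFinPart W (t' : GA W) ∈ torusT' W),
          0 < (R.chi ⟨_, ht⟩ * conj (R.chi' ⟨_, ht'⟩)).re := by
  classical
  haveI : T2Space (GA W) := t2Space_GA W
  -- the finite-part orbit map, the compact domain and the open target
  set γf : GA W := GA.ofFinPart W (γ₀ : GA W) with hγf
  set f : torusT W × torusT' W → GA W := fun p => GA.ofFinPart W ((p.1 : GA W)⁻¹ * γ₀ * p.2) with hfdef
  have hf : Continuous f :=
    (continuous_ofFinPart W).comp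
      (((continuous_subtype_val.comp continuous_fst).inv.mul continuous_const).mul
        (continuous_subtype_val.comp continuous_snd))
  set D : Set (torusT W × torusT' W) := closure R.DT ×ˢ closure R.DT' with hDdef
  have hD : IsCompact D := hT.prod hT'
  have hDc : IsClosed D := isClosed_closure.prod isClosed_closure
  set U : Set (torusT W × torusT' W) :=
    {p | 0 < (R.chi (finT W p.1) * conj (R.chi' (finT' W p.2))).re} with hUdef
  have hU : IsOpen U :=
    isOpen_lt continuous_const
      (Complex.continuous_re.comp ((hχ.comp ((continuous_finT W).comp continuous_fst)).mul
        (Complex.continuous_conj.comp (hχ'.comp ((continuous_finT' W).comp continuous_snd)))))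
  -- the fibre over `γf` lies in `U`
  have hfib : ∀ p : torusT W × torusT' W, f p = γf → p ∈ U := by
    rintro ⟨t, t'⟩ hp
    have hp' : (GA.ofFinPart W (t : GA W))⁻¹ * (γ₀ : GA W) * GA.ofFinPart W (t' : GA W) = γ₀ :=
      ofFinPart_conj_eq_of_ofFinPart_eq W (γ₀ : GA W) t t' hp
    obtain ⟨hz, hte⟩ := hreg _ (ofFinPart_mem_torusT W t.2) _ (ofFinPart_mem_torusT' W t'.2) hp'
    exact re_pos_of_stabiliser W R hχ1 (finT W t) (finT' W t') hz hte
  -- the decreasing compact sets `A n = D ∩ f⁻¹(K((n+1)!) γf K((n+1)!)) ∩ Uᶜ`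
  set A : ℕ → Set (torusT W × torusT' W) :=
    fun n => D ∩ f ⁻¹' levelDoubleCoset W (n + 1).factorial γf ∩ Uᶜ with hAdef
  have hAcl : ∀ n, IsClosed (A n) := fun n =>
    (hDc.inter ((isCompact_levelDoubleCoset W (Nat.factorial_ne_zero _) γf).isClosed.preimage hf)).inter
      hU.isClosed_compl
  have hAanti : ∀ n, A (n + 1) ⊆ A n := by
    intro n p hp
    refine ⟨⟨hp.1.1, ?_⟩, hp.2⟩
    exact levelDoubleCoset_antitone W (Nat.factorial_dvd_factorial (Nat.le_succ (n + 1))) _ hp.1.2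
  have hA0 : IsCompact (A 0) := hD.of_isClosed_subset (hAcl 0) (fun p hp => hp.1.1)
  -- some `A n` is empty
  have hempty : ∃ n, ¬ (A n).Nonempty := by
    by_contra hall
    have hall' : ∀ n, (A n).Nonempty := fun n => by_contra fun h => hall ⟨n, h⟩
    obtain ⟨p, hp⟩ := IsCompact.nonempty_iInter_of_sequence_nonempty_isCompact_isClosed A hAanti hall' hA0 hAcl
    have hmem : ∀ n, f p ∈ levelDoubleCoset W (n + 1).factorial γf := fun n => (Set.mem_iInter.1 hp n).1.2
    have hfp : f p = γf := eq_of_mem_levelDoubleCoset_factorial W γf (f p) hmem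
    exact (Set.mem_iInter.1 hp 0).2 (hfib p hfp)
  obtain ⟨n, hn⟩ := hempty
  refine ⟨(n + 1).factorial, Nat.factorial_ne_zero _, fun t ht t' ht' hmem htm htm' => ?_⟩
  by_contra hneg
  apply hn
  have hmem' : (t, t') ∈ f ⁻¹' levelDoubleCoset W (n + 1).factorial γf := hmem
  have hneg' : (t, t') ∈ Uᶜ := hneg
  exact ⟨(t, t'), ⟨⟨Set.mk_mem_prod ht ht', hmem'⟩, hneg'⟩⟩

end Summit.Ventures.HodgeRepro.Tier4.Line4

end
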